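import Summits.NavierStokesRegularity.NavierStokesRegularity.Theorems.GaldiLiouvilleGateParabolicGaldiLiouvilleStubOseenMildOfL6
import Literature.Analysis.FluidPDE.OseenHeatKernelBridge
import HarnessLib

/-!
# Crux `ParabolicGaldiLiouville` (stmt-NavierStokesRegularity-0893), line `birth`, reshaping 4:
# STUB `stub_l6Stability` — small-data `L⁶` stability up to the final time, Oseen class

Lands `--supports stmt-NavierStokesRegularity-0893` the registered stub `stub_l6Stability` of the
lead's sharp two-gate skeleton (lead c2): there is a universal `η > 0` such that for every
bounded ancient mild solution `v` of Navier–Stokes (`ν = 1`, duality form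
`IsBoundedAncientMildSolution 1 v`), continuous on `(−∞,0) × ℝ³`, with uniformly-`L⁶` slices,
and every `s < 0` with `‖v(s)‖_{L⁶} · |s|^{1/4} ≤ η`, one has `‖v(t)‖_{L⁶} ≤ 4 ‖v(s)‖_{L⁶}` for
a.e. `t ∈ (s, 0)`.

Proof. The class is Oseen-mild (the landed sibling stub `stub_oseenMildOfL6`). On the window
`(s − 1, 0)` shifted to `(0, 1 − s)` the zero-extended field `U(σ) = v(σ + s − 1)` is jointly
measurable, bounded, weakly divergence free at every window time and — by the bridge
`driftDuhamel_zero_eq_oseenDuhamel` and time translation of the Duhamel term — drift-mild with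
ZERO drift in the sense of KNSS 2009, Lemma 3.1 (`IsKNSSDriftMild (1 − s) C U 0`,
`L6Stability.isKNSSDriftMild_of_eqOn_window`). Its window Ladyzhenskaya–Prodi–Serrin quantity
`∫₀^{1−s} ‖U(σ)‖₆⁴ dσ ≤ K⁴ (1 − s)` is finite, so the tree's window stability theorem
`IsKNSSDriftMild.exists_eta_ae_eLpNorm_le_four_mul` at `p = 6`, `l = 4`
(`1/2 − 3/(2·6) = 1/4`) applies at the window time `1` (original time `s`, `(1 − s) − 1 = −s`);
the a.e. conclusion on `(1, 1 − s)` is transported back to `(s, 0)` by the measure-preserving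
time shift.

References: G. Koch, N. Nadirashvili, G. Seregin, V. Šverák, Acta Math. 203 (2009) =
arXiv:0709.3599, §3 Lemma 3.1, §4 (i); G. Seregin, *Lecture Notes on Regularity Theory for the
Navier–Stokes Equations* (2014), Ch. 6, Thm. 4.12 (small-data stability engine of its tree
discharge); T. Kato, Math. Z. 187 (1984), §2.
-/

noncomputable section

-- `Sub = summit`: the duplicated namespace component `NavierStokesRegularity` is deliberate.
set_option linter.dupNamespace false

open MeasureTheory Set Function Filter TopologicalSpace Metric
open Topology
open scoped ENNReal NNReal RealInnerProductSpace
open Literature.Analysis Literature.Analysis.FluidPDE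

namespace Summit.NavierStokesRegularity.NavierStokesRegularity.Theorems

namespace ParabolicGaldiLiouville.Birth

namespace L6Stability

/-- **Zero-drift drift-mild representative on a shifted window.** Let `v` be a bounded ancient
mild solution (`ν = 1`, duality form), continuous on `(−∞,0) × ℝ³`, with uniformly-`L⁶` slices and
`‖v‖ ≤ C` (`0 ≤ C`), and let `U` be jointly measurable with `U(σ) = v(σ + a)` for all window
times `σ ∈ (0, T)`, where `T + a ≤ 0`. Then `(U, 0)` is a drift-mild pair on `(0, T)` with bound
`C` (KNSS 2009, Lemma 3.1 form, `IsKNSSDriftMild T C U 0`): the drift-mild identity is the Oseen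
integral equation of `v` (`stub_oseenMildOfL6`) between the original times `s + a < t + a < 0`,
through the bridge `driftDuhamel_zero_eq_oseenDuhamel` and `oseenDuhamel_translate`. -/
theorem isKNSSDriftMild_of_eqOn_window
    {v U : ℝ → EuclideanSpace ℝ (Fin 3) → EuclideanSpace ℝ (Fin 3)}
    (hv : IsBoundedAncientMildSolution 1 v) (hcont : ContinuousOn (uncurry v) (Iio 0 ×ˢ univ))
    {K : ℝ≥0} (hK : ∀ s < 0, eLpNorm (v s) 6 volume ≤ K)
    {C : ℝ} (hC : ∀ t ∈ Iio 0, ∀ x, ‖v t x‖ ≤ C) (hC0 : 0 ≤ C)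
    {a T : ℝ} (haT : T + a ≤ 0)
    (hUm : Measurable (uncurry U)) (hUw : ∀ σ ∈ Ioo 0 T, U σ = v (σ + a)) :
    IsKNSSDriftMild T C U 0 where
  measurable_drift := measurable_zero
  norm_drift_le _ := by simpa only [Pi.zero_apply, norm_zero] using hC0
  measurable := hUm
  norm_le t ht x := by
    rw [hUw t ht]
    exact hC (t + a) (show t + a < 0 by linarith [ht.2]) x
  ae_isWeaklyDivFree := by
    filter_upwards [ae_restrict_mem measurableSet_Ioo] with t ht
    rw [hUw t ht]
    exact hv.1.1 (t + a) (by linarith [ht.2])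
  mild s t hs hst htT x := by
    have hE : Module.finrank ℝ (EuclideanSpace ℝ (Fin 3)) = 3 := finrank_euclideanSpace_fin
    have hsub : Ioo s t ⊆ Ioo 0 T := Ioo_subset_Ioo hs.le htT.le
    have hUsl : ∀ σ ∈ Ioo s t, Measurable (U σ) := fun σ _ => hUm.of_uncurry_left
    have hUN : ∀ σ ∈ Ioo s t, ∀ y, ‖U σ y‖ ≤ C := fun σ hσ y => by
      rw [hUw σ (hsub hσ)]
      exact hC (σ + a) (show σ + a < 0 by linarith [hσ.2]) y
    -- the Duhamel term: bridge, a.e. identification of the slices, time translation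
    have hduh : driftDuhamel U 0 s t x = oseenDuhamel 1 (s + a) v v (t + a) x := by
      rw [driftDuhamel_zero_eq_oseenDuhamel hE hUsl hUN hst.le x,
        ← oseenDuhamel_translate 1 s a v v t x]
      refine oseenDuhamel_congr_ae_slices ?_ x
      filter_upwards [ae_restrict_mem measurableSet_Ioo] with σ hσ
      exact Eventually.of_forall fun y => by rw [hUw σ (hsub hσ)]
    -- the Oseen integral equation of `v` between `s + a < t + a < 0`
    have key := stub_oseenMildOfL6 v hv hcont ⟨K, hK⟩ (s + a) (t + a) (by linarith)
      (by linarith) x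
    rw [hUw t ⟨hs.trans hst, htT⟩, hUw s ⟨hs, hst.trans htT⟩, hduh, key,
      add_sub_add_right_eq_sub]

end L6Stability

open L6Stability in
/-- **STUB S — `stub_l6Stability` (lead c2, reshaping 4): small-data `L⁶` stability up to the
final time, in the Oseen class.** There is a universal `η > 0` such that for every bounded
ancient mild solution `v` (`ν = 1`, duality form), continuous on `(−∞,0) × ℝ³` with
uniformly-`L⁶` slices, and every `s < 0` with `‖v(s)‖_{L⁶} · |s|^{1/4} ≤ η`, one has
`‖v(t)‖_{L⁶} ≤ 4 ‖v(s)‖_{L⁶}` for a.e. `t ∈ (s, 0)`. Proof: `η` is the constant of the tree's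
window stability theorem `IsKNSSDriftMild.exists_eta_ae_eLpNorm_le_four_mul` at `p = 6`, `l = 4`;
given `v` and `s`, the zero-extended shift `U(σ) = v(σ + s − 1)` on the window `(0, 1 − s)` is a
zero-drift drift-mild pair (`isKNSSDriftMild_of_eqOn_window`) with finite window LPS quantity
`∫ ‖U‖₆⁴ ≤ K⁴ (1 − s)`; the smallness hypothesis is the theorem's at window time `1`
(`(1 − s) − 1 = −s`, `1/2 − 3/12 = 1/4`), and the a.e. bound on `(1, 1 − s)` is carried back to
`(s, 0)` by the measure-preserving shift `t ↦ t − (s − 1)`. -/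
theorem stub_l6Stability :
    ∃ η : ENNReal, 0 < η ∧
      ∀ v : ℝ → EuclideanSpace ℝ (Fin 3) → EuclideanSpace ℝ (Fin 3),
        Literature.Analysis.FluidPDE.IsBoundedAncientMildSolution 1 v →
        ContinuousOn (Function.uncurry v) (Set.Iio 0 ×ˢ Set.univ) →
        (∃ K : NNReal, ∀ s < 0, MeasureTheory.eLpNorm (v s) 6 MeasureTheory.volume ≤ K) →
        ∀ s : ℝ, s < 0 →
          MeasureTheory.eLpNorm (v s) 6 MeasureTheory.volume * ENNReal.ofReal ((-s) ^ (1 / 4 : ℝ)) ≤ η →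
          ∀ᵐ t ∂(MeasureTheory.volume.restrict (Set.Ioo s 0)),
            MeasureTheory.eLpNorm (v t) 6 MeasureTheory.volume ≤
              4 * MeasureTheory.eLpNorm (v s) 6 MeasureTheory.volume := by
  -- ### the universal constant (depends on `p = 6`, `l = 4`, `E = ℝ³` only)
  have hE : Module.finrank ℝ (EuclideanSpace ℝ (Fin 3)) = 3 := finrank_euclideanSpace_fin
  have hp₃ : (3 : ℝ≥0∞) < 6 := by norm_num
  have hp : (6 : ℝ≥0∞) < ∞ := ENNReal.ofNat_lt_top
  have hl : (2 : ℝ) < 4 := by norm_num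
  obtain ⟨η, hη0, hstab⟩ :=
    IsKNSSDriftMild.exists_eta_ae_eLpNorm_le_four_mul (E := EuclideanSpace ℝ (Fin 3)) hE hp₃ hp hl
  refine ⟨η, hη0, ?_⟩
  intro v hv hcont hK6 s hs0 hsmall
  obtain ⟨K, hK⟩ := hK6
  obtain ⟨C, hC⟩ := hv.2
  have hC0 : 0 ≤ C := (norm_nonneg _).trans (hC s hs0 0)
  -- ### the window `(a, 0)`, `a = s - 1`, shifted to `(0, T)`, `T = 1 - s`
  set a : ℝ := s - 1 with ha
  set T : ℝ := 1 - s with hT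
  have haT : T + a ≤ 0 := by rw [hT, ha]; linarith
  have h1T : (1 : ℝ) < T := by rw [hT]; linarith
  have h1a : 1 + a = s := by rw [ha]; ring
  have hT1 : T - 1 = -s := by rw [hT]; ring
  -- ### the zero-extended measurable representative on the window
  classical
  set w : ℝ → EuclideanSpace ℝ (Fin 3) → EuclideanSpace ℝ (Fin 3) := fun τ => v (τ + a)
  set U : ℝ → EuclideanSpace ℝ (Fin 3) → EuclideanSpace ℝ (Fin 3) := fun σ y =>
    (Ioo 0 T ×ˢ univ).piecewise (uncurry w) 0 (σ, y)
  have hUw : ∀ σ ∈ Ioo 0 T, U σ = v (σ + a) := fun σ hσ => funext fun y =>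
    (Ioo 0 T ×ˢ univ).piecewise_eq_of_mem _ _ (mk_mem_prod hσ (mem_univ y))
  have hcontw : ContinuousOn (uncurry w) (Ioo 0 T ×ˢ univ) := by
    refine hcont.comp (f := fun q : ℝ × EuclideanSpace ℝ (Fin 3) => (q.1 + a, q.2))
      ((continuous_fst.add continuous_const).prodMk continuous_snd).continuousOn ?_
    intro q hq
    exact ⟨show q.1 + a < 0 by linarith [hq.1.2], mem_univ _⟩
  have hUm : Measurable (uncurry U) :=
    hcontw.measurable_piecewise continuousOn_const (measurableSet_Ioo.prod MeasurableSet.univ)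
  -- ### zero-drift drift-mild pair on the window
  have hUb : IsKNSSDriftMild T C U 0 :=
    isKNSSDriftMild_of_eqOn_window hv hcont hK hC hC0 haT hUm hUw
  have hV : ∀ σ y, U σ y = U σ y + (0 : ℝ → EuclideanSpace ℝ (Fin 3)) σ := fun σ y => by
    simp only [Pi.zero_apply, add_zero]
  -- ### the window LPS quantity `∫ ‖U‖₆⁴ ≤ K⁴ · T < ∞`
  have hUK : ∀ σ ∈ Ioo 0 T, eLpNorm (U σ) 6 volume ≤ K := fun σ hσ => by
    rw [hUw σ hσ]
    exact hK (σ + a) (by linarith [hσ.2])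
  have hLV : (∫⁻ σ in Ioo 0 T, eLpNorm (U σ) 6 volume ^ (4 : ℝ)) ≠ ∞ := by
    have h1 : (∫⁻ σ in Ioo 0 T, eLpNorm (U σ) 6 volume ^ (4 : ℝ)) ≤
        ∫⁻ _ in Ioo 0 T, (K : ℝ≥0∞) ^ (4 : ℝ) :=
      setLIntegral_mono' measurableSet_Ioo fun σ hσ =>
        ENNReal.rpow_le_rpow (hUK σ hσ) (by norm_num)
    refine ne_top_of_le_ne_top ?_ h1
    rw [setLIntegral_const, Real.volume_Ioo]
    exact ENNReal.mul_ne_top (ENNReal.rpow_ne_top_of_nonneg (by norm_num) ENNReal.coe_ne_top)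
      ENNReal.ofReal_ne_top
  -- ### the initial window time `1` (original time `s`)
  have hU1 : U 1 = v s := by rw [hUw 1 ⟨one_pos, h1T⟩, h1a]
  have hδ : eLpNorm (U 1) 6 volume ≠ ∞ := by
    rw [hU1]
    exact ((hK s hs0).trans_lt ENNReal.coe_lt_top).ne
  have hexp : (1 : ℝ) / 2 - 3 / (2 * (6 : ℝ≥0∞).toReal) = 1 / 4 := by
    rw [ENNReal.toReal_ofNat]; norm_num
  have hsm : eLpNorm (U 1) 6 volume *
      ENNReal.ofReal ((T - 1) ^ (1 / 2 - 3 / (2 * (6 : ℝ≥0∞).toReal))) ≤ η := by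
    rw [hU1, hT1, hexp]
    exact hsmall
  -- ### the window stability theorem
  have hwin : ∀ᵐ t ∂(volume.restrict (Ioo 1 T)),
      eLpNorm (U t) 6 volume ≤ 4 * eLpNorm (U 1) 6 volume :=
    hstab hUb hV hLV (show (0 : ℝ) < 1 from one_pos) h1T hδ hsm
  -- ### back to `v`: window time, then original time
  have hwin' : ∀ᵐ t ∂(volume : Measure ℝ), t ∈ Ioo 1 T →
      eLpNorm (v (t + a)) 6 volume ≤ 4 * eLpNorm (v s) 6 volume := by
    have h2 : ∀ᵐ t ∂(volume.restrict (Ioo 1 T)),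
        eLpNorm (v (t + a)) 6 volume ≤ 4 * eLpNorm (v s) 6 volume := by
      filter_upwards [hwin, ae_restrict_mem measurableSet_Ioo] with t ht htI
      rwa [hUw t ⟨one_pos.trans htI.1, htI.2⟩, hU1] at ht
    exact (ae_restrict_iff' measurableSet_Ioo).1 h2
  have hwin'' : ∀ᵐ τ ∂(volume : Measure ℝ), τ - a ∈ Ioo 1 T →
      eLpNorm (v τ) 6 volume ≤ 4 * eLpNorm (v s) 6 volume := by
    have h := (measurePreserving_sub_right (volume : Measure ℝ) a).quasiMeasurePreserving.ae hwin'
    filter_upwards [h] with τ hτ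
    simpa only [sub_add_cancel] using hτ
  refine (ae_restrict_iff' measurableSet_Ioo).2 ?_
  filter_upwards [hwin''] with τ hτ hτI
  refine hτ ⟨?_, ?_⟩
  · rw [ha]; linarith [hτI.1]
  · rw [ha, hT]; linarith [hτI.2]

end ParabolicGaldiLiouville.Birth

end Summit.NavierStokesRegularity.NavierStokesRegularity.Theorems
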